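import Literature.Computability.AlgebraicComplexity.FormulaUnfolding
import HarnessLib

/-!
# Formula unfolding, II: depth and root-to-leaf walks of weighted expressions

Sequel to `FormulaUnfolding.lean` (the transport between fan-in-two `ArithCircuit` formulas and the
weighted binary expressions `WExpr k σ`).  This file adds

* the DEPTH of a weighted expression (`WExpr.depth`: leaves `0`, a `lin`/`mul` node one more than
  its deeper child — BCS 1997 (21.35): "the depth of an expression"), and the exact counterpart of
  the size theorem of part I: **the unfolding of a fan-in-two circuit has depth at most the depth
  of the circuit** (`ArithCircuit.depth_toWExpr_le`; the circuit depth is the tree's fold-based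
  `ArithCircuit.depth` of `CircuitDepth.lean`, every gate weighing `1`, junk references `0`);
  unconditionally in the number of gates referenced — no read-once hypothesis is needed for depth;
* ROOT-TO-LEAF WALKS (plumbing for top-down arguments on formulas, e.g. Karchmer–Wigderson style
  walk-downs): the children `WExpr.left` / `WExpr.right` (a leaf is its own child), the step
  `WExpr.child d` (`d = false`: left, `d = true`: right), the walk `WExpr.descend l` along a list of
  directions, the root variable `WExpr.rootVar`; with `depth (e.child d) ≤ depth e - 1`,
  `depth (e.descend l) ≤ depth e - l.length`, and "depth `0` = leaf"
  (`WExpr.exists_eq_var_or_const_of_depth_eq_zero`), so that a walk of length `≥ depth e` ends at a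
  leaf (`WExpr.descend_eq_var_or_const`).

Sources: P. Bürgisser, M. Clausen, M. A. Shokrollahi, *Algebraic Complexity Theory* (1997), §21.1
(21.19) (expressions) and §21.5 (21.35) (depth of expressions, Brent); P. Bürgisser, *Completeness
and Reduction in Algebraic Complexity Theory* (2000), Def. 2.1 (depth of straight-line programs).
Everything is elementary; VP ≠ VNP is not touched by anything here.
-/

noncomputable section

open MvPolynomial

namespace Literature.Computability.AlgebraicComplexity

universe u v

namespace WExpr

variable {k : Type u} {σ : Type v}

/-! ## Depth -/

/-- The depth of a weighted expression: leaves have depth `0`, a node one more than its deeper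
child (BCS 1997, (21.35): depth of an expression). [cite: BurgisserClausenShokrollahi1997, (21.35)] -/
def depth : WExpr k σ → ℕ
  | var _ => 0
  | const _ => 0
  | lin _ e₁ _ e₂ => max e₁.depth e₂.depth + 1
  | mul e₁ e₂ => max e₁.depth e₂.depth + 1

/-- Unfolding: `depth (var i) = 0`. [cite: BurgisserClausenShokrollahi1997, (21.35)] -/
@[simp] theorem depth_var (i : σ) : (var i : WExpr k σ).depth = 0 := rfl
/-- Unfolding: `depth (const c) = 0`. [cite: BurgisserClausenShokrollahi1997, (21.35)] -/
@[simp] theorem depth_const (c : k) : (const c : WExpr k σ).depth = 0 := rfl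
/-- Unfolding: `depth (lin c₁ e₁ c₂ e₂) = max (depth e₁) (depth e₂) + 1`. [cite: BurgisserClausenShokrollahi1997, (21.35)] -/
@[simp] theorem depth_lin (c₁ : k) (e₁ : WExpr k σ) (c₂ : k) (e₂ : WExpr k σ) :
    (lin c₁ e₁ c₂ e₂).depth = max e₁.depth e₂.depth + 1 := rfl
/-- Unfolding: `depth (mul e₁ e₂) = max (depth e₁) (depth e₂) + 1`. [cite: BurgisserClausenShokrollahi1997, (21.35)] -/
@[simp] theorem depth_mul (e₁ e₂ : WExpr k σ) : (mul e₁ e₂).depth = max e₁.depth e₂.depth + 1 := rfl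

/-- An expression of depth `0` is a leaf: a variable or a constant. [cite: BurgisserClausenShokrollahi1997, (21.19)] -/
theorem exists_eq_var_or_const_of_depth_eq_zero {e : WExpr k σ} (h : e.depth = 0) :
    (∃ i, e = var i) ∨ ∃ c, e = const c := by
  cases e with
  | var i => exact Or.inl ⟨i, rfl⟩
  | const c => exact Or.inr ⟨c, rfl⟩
  | lin c₁ e₁ c₂ e₂ => simp at h
  | mul e₁ e₂ => simp at h

/-! ## Root-to-leaf walks -/

/-- The left child of a node (`e₁` of `lin c₁ e₁ c₂ e₂` / `mul e₁ e₂`); a leaf is its own left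
child. [cite: BurgisserClausenShokrollahi1997, (21.19)] -/
def left : WExpr k σ → WExpr k σ
  | lin _ e₁ _ _ => e₁
  | mul e₁ _ => e₁
  | e => e

/-- The right child of a node (`e₂` of `lin c₁ e₁ c₂ e₂` / `mul e₁ e₂`); a leaf is its own right
child. [cite: BurgisserClausenShokrollahi1997, (21.19)] -/
def right : WExpr k σ → WExpr k σ
  | lin _ _ _ e₂ => e₂
  | mul _ e₂ => e₂
  | e => e

/-- One step of a root-to-leaf walk: direction `false` goes left, `true` goes right. [cite: BurgisserClausenShokrollahi1997, (21.19)] -/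
def child (e : WExpr k σ) (d : Bool) : WExpr k σ :=
  if d then e.right else e.left

/-- The walk from the root along a list of directions (first direction first). [cite: BurgisserClausenShokrollahi1997, (21.19)] -/
def descend (e : WExpr k σ) (l : List Bool) : WExpr k σ :=
  l.foldl child e

/-- The variable at the root, if the root is a variable leaf. [cite: BurgisserClausenShokrollahi1997, (21.19)] -/
def rootVar : WExpr k σ → Option σ
  | var i => some i
  | _ => none

/-- Unfolding: `left (lin c₁ e₁ c₂ e₂) = e₁`. [cite: BurgisserClausenShokrollahi1997, (21.19)] -/
@[simp] theorem left_lin (c₁ : k) (e₁ : WExpr k σ) (c₂ : k) (e₂ : WExpr k σ) :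
    (lin c₁ e₁ c₂ e₂).left = e₁ := rfl
/-- Unfolding: `right (lin c₁ e₁ c₂ e₂) = e₂`. [cite: BurgisserClausenShokrollahi1997, (21.19)] -/
@[simp] theorem right_lin (c₁ : k) (e₁ : WExpr k σ) (c₂ : k) (e₂ : WExpr k σ) :
    (lin c₁ e₁ c₂ e₂).right = e₂ := rfl
/-- Unfolding: `left (mul e₁ e₂) = e₁`. [cite: BurgisserClausenShokrollahi1997, (21.19)] -/
@[simp] theorem left_mul (e₁ e₂ : WExpr k σ) : (mul e₁ e₂).left = e₁ := rfl
/-- Unfolding: `right (mul e₁ e₂) = e₂`. [cite: BurgisserClausenShokrollahi1997, (21.19)] -/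
@[simp] theorem right_mul (e₁ e₂ : WExpr k σ) : (mul e₁ e₂).right = e₂ := rfl
/-- Unfolding: `left (var i) = var i`. [cite: BurgisserClausenShokrollahi1997, (21.19)] -/
@[simp] theorem left_var (i : σ) : (var i : WExpr k σ).left = var i := rfl
/-- Unfolding: `right (var i) = var i`. [cite: BurgisserClausenShokrollahi1997, (21.19)] -/
@[simp] theorem right_var (i : σ) : (var i : WExpr k σ).right = var i := rfl
/-- Unfolding: `left (const c) = const c`. [cite: BurgisserClausenShokrollahi1997, (21.19)] -/
@[simp] theorem left_const (c : k) : (const c : WExpr k σ).left = const c := rfl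
/-- Unfolding: `right (const c) = const c`. [cite: BurgisserClausenShokrollahi1997, (21.19)] -/
@[simp] theorem right_const (c : k) : (const c : WExpr k σ).right = const c := rfl
/-- Unfolding: `rootVar (var i) = some i`. [cite: BurgisserClausenShokrollahi1997, (21.19)] -/
@[simp] theorem rootVar_var (i : σ) : (var i : WExpr k σ).rootVar = some i := rfl
/-- Unfolding: `rootVar (const c) = none`. [cite: BurgisserClausenShokrollahi1997, (21.19)] -/
@[simp] theorem rootVar_const (c : k) : (const c : WExpr k σ).rootVar = none := rfl

/-- A leaf is its own child. [cite: BurgisserClausenShokrollahi1997, (21.19)] -/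
@[simp] theorem child_var (i : σ) (d : Bool) : (var i : WExpr k σ).child d = var i := by
  cases d <;> rfl
/-- A leaf is its own child. [cite: BurgisserClausenShokrollahi1997, (21.19)] -/
@[simp] theorem child_const (c : k) (d : Bool) : (const c : WExpr k σ).child d = const c := by
  cases d <;> rfl
/-- Unfolding: `child e false = left e`. [cite: BurgisserClausenShokrollahi1997, (21.19)] -/
@[simp] theorem child_false (e : WExpr k σ) : e.child false = e.left := rfl
/-- Unfolding: `child e true = right e`. [cite: BurgisserClausenShokrollahi1997, (21.19)] -/
@[simp] theorem child_true (e : WExpr k σ) : e.child true = e.right := rfl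

/-- The empty walk stays at the root. [cite: BurgisserClausenShokrollahi1997, (21.19)] -/
@[simp] theorem descend_nil (e : WExpr k σ) : e.descend [] = e := rfl
/-- A walk, first step first. [cite: BurgisserClausenShokrollahi1997, (21.19)] -/
theorem descend_cons (e : WExpr k σ) (d : Bool) (l : List Bool) :
    e.descend (d :: l) = (e.child d).descend l := rfl
/-- A walk, last step last. [cite: BurgisserClausenShokrollahi1997, (21.19)] -/
theorem descend_append_singleton (e : WExpr k σ) (l : List Bool) (d : Bool) :
    e.descend (l ++ [d]) = (e.descend l).child d := by
  simp [descend, List.foldl_append]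
/-- A walk from a leaf stays at the leaf. [cite: BurgisserClausenShokrollahi1997, (21.19)] -/
@[simp] theorem descend_var (i : σ) (l : List Bool) : (var i : WExpr k σ).descend l = var i := by
  induction l with
  | nil => rfl
  | cons d l ih => rw [descend_cons, child_var, ih]
/-- A walk from a leaf stays at the leaf. [cite: BurgisserClausenShokrollahi1997, (21.19)] -/
@[simp] theorem descend_const (c : k) (l : List Bool) : (const c : WExpr k σ).descend l = const c := by
  induction l with
  | nil => rfl
  | cons d l ih => rw [descend_cons, child_const, ih]

/-- The left child is less deep (unless the node is a leaf). [cite: BurgisserClausenShokrollahi1997, (21.35)] -/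
theorem depth_left_le (e : WExpr k σ) : e.left.depth ≤ e.depth - 1 := by
  cases e <;> simp [left]
/-- The right child is less deep (unless the node is a leaf). [cite: BurgisserClausenShokrollahi1997, (21.35)] -/
theorem depth_right_le (e : WExpr k σ) : e.right.depth ≤ e.depth - 1 := by
  cases e <;> simp [right]
/-- One step down loses one unit of depth (at a leaf, nothing). [cite: BurgisserClausenShokrollahi1997, (21.35)] -/
theorem depth_child_le (e : WExpr k σ) (d : Bool) : (e.child d).depth ≤ e.depth - 1 := by
  cases d
  · exact depth_left_le e
  · exact depth_right_le e

/-- A walk of length `ℓ` loses `ℓ` units of depth: `depth (e.descend l) ≤ depth e - |l|`. [cite: BurgisserClausenShokrollahi1997, (21.35)] -/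
theorem depth_descend_le (e : WExpr k σ) (l : List Bool) :
    (e.descend l).depth ≤ e.depth - l.length := by
  induction l using List.reverseRecOn with
  | nil => simp
  | append_singleton l d ih =>
    rw [descend_append_singleton, List.length_append, List.length_singleton]
    have := depth_child_le (e.descend l) d
    omega

/-- **A walk of length at least the depth ends at a leaf** (a variable or a constant). [cite: BurgisserClausenShokrollahi1997, (21.35)] -/
theorem descend_eq_var_or_const {e : WExpr k σ} {l : List Bool} (h : e.depth ≤ l.length) :
    (∃ i, e.descend l = var i) ∨ ∃ c, e.descend l = const c :=
  exists_eq_var_or_const_of_depth_eq_zero (by have := depth_descend_le e l; omega)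

end WExpr

/-! ## The unfolding does not increase the depth -/

namespace ArithCircuit

variable {k : Type u} {σ : Type v} [Zero k] [One k]

/-- Depth of the unfolding of a weighted-sum gate of fan-in at most two: one more than the deeper
operand (the right fold of `max` over the operand depths, as in `gateWDepths`). [cite: Burgisser2000, Def. 2.1] -/
theorem depth_sumWExpr_le (es : List (WExpr k σ)) (ds : List ℕ)
    (hes : ∀ u : Operand k σ, (u.wexprIn es).depth ≤ u.depthIn ds) {args : List (k × Operand k σ)}
    (h : args.length ≤ 2) :
    (sumWExpr es args).depth ≤ 1 + ((args.map Prod.snd).map (Operand.depthIn ds)).foldr max 0 := by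
  match args, h with
  | [], _ => simp [sumWExpr]
  | [a], _ =>
    simp only [sumWExpr, WExpr.depth_lin, WExpr.depth_const, List.map_cons, List.map_nil,
      List.foldr_cons, List.foldr_nil]
    have := hes a.2
    omega
  | [a, b], _ =>
    simp only [sumWExpr, WExpr.depth_lin, List.map_cons, List.map_nil, List.foldr_cons,
      List.foldr_nil]
    have := hes a.2
    have := hes b.2
    omega

/-- Depth of the unfolding of a product gate of fan-in at most two. [cite: Burgisser2000, Def. 2.1] -/
theorem depth_prodWExpr_le (es : List (WExpr k σ)) (ds : List ℕ)
    (hes : ∀ u : Operand k σ, (u.wexprIn es).depth ≤ u.depthIn ds) {args : List (Operand k σ)}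
    (h : args.length ≤ 2) :
    (prodWExpr es args).depth ≤ 1 + (args.map (Operand.depthIn ds)).foldr max 0 := by
  match args, h with
  | [], _ => simp [prodWExpr]
  | [u], _ =>
    simp only [prodWExpr, List.map_cons, List.map_nil, List.foldr_cons, List.foldr_nil]
    have := hes u
    omega
  | [u, v], _ =>
    simp only [prodWExpr, WExpr.depth_mul, List.map_cons, List.map_nil, List.foldr_cons,
      List.foldr_nil]
    have := hes u
    have := hes v
    omega

/-- Depth of the unfolding of a gate of fan-in at most two against the weighted gate depths with
unit weights. [cite: Burgisser2000, Def. 2.1] -/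
theorem depth_toWExpr_gate_le (es : List (WExpr k σ)) (ds : List ℕ)
    (hes : ∀ u : Operand k σ, (u.wexprIn es).depth ≤ u.depthIn ds) {g : Gate k σ}
    (hg : g.fanIn ≤ 2) :
    (g.toWExpr es).depth ≤ 1 + ((g.args.map (Operand.depthIn ds)).foldr max 0) := by
  cases g with
  | sum args =>
    have h : args.length ≤ 2 := by simpa [Gate.fanIn, Gate.args] using hg
    simpa [Gate.toWExpr, Gate.args, List.map_map] using depth_sumWExpr_le es ds hes h
  | prod args =>
    have h : args.length ≤ 2 := by simpa [Gate.fanIn, Gate.args] using hg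
    simpa [Gate.toWExpr, Gate.args] using depth_prodWExpr_le es ds hes h

/-- **Unfolding does not increase depth, operand by operand**: against a fan-in-two gate list, the
depth of the unfolding of any operand is at most its (unit-weight) depth in the circuit. [cite: Burgisser2000, Def. 2.1] -/
theorem depth_wexprIn_le (gs : List (Gate k σ)) (h2 : ∀ g ∈ gs, g.fanIn ≤ 2) (u : Operand k σ) :
    (u.wexprIn (gateWExprs gs)).depth ≤ u.depthIn (gateWDepths (fun _ => 1) gs) := by
  induction gs using List.reverseRecOn generalizing u with
  | nil => cases u <;> simp [Operand.wexprIn, Operand.depthIn, gateWExprs, gateWDepths]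
  | append_singleton gs g ih =>
    have ih' := fun v => ih (fun g' hg' => h2 g' (by simp [hg'])) v
    have hg : g.fanIn ≤ 2 := h2 g (by simp)
    have hlenE := gateWExprs_length (k := k) gs
    have hlenD := gateWDepths_length (fun _ : Gate k σ => (1 : ℕ)) gs
    cases u with
    | var i => simp [Operand.wexprIn, Operand.depthIn]
    | const c => simp [Operand.wexprIn, Operand.depthIn]
    | gate j =>
      simp only [Operand.wexprIn, Operand.depthIn, gateWExprs_append_singleton,
        gateWDepths_append_singleton, List.getD_eq_getElem?_getD]
      rcases lt_trichotomy j gs.length with hj | rfl | hj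
      · rw [List.getElem?_append_left (by omega), List.getElem?_append_left (by omega)]
        have := ih' (Operand.gate j)
        simpa [Operand.wexprIn, Operand.depthIn, List.getD_eq_getElem?_getD] using this
      · rw [List.getElem?_append_right (by omega), List.getElem?_append_right (by omega), hlenE,
          hlenD, Nat.sub_self]
        simpa using depth_toWExpr_gate_le (gateWExprs gs) (gateWDepths (fun _ => 1) gs) ih' hg
      · have h1 : (gateWExprs gs ++ [g.toWExpr (gateWExprs gs)])[j]? = none :=
          List.getElem?_eq_none_iff.2 (by simp [hlenE]; omega)
        rw [h1]
        simp

/-- **The unfolding of a fan-in-two circuit has depth at most the depth of the circuit**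
(`ArithCircuit.depth`: unit weight per gate, junk references `0`). [cite: BurgisserClausenShokrollahi1997, (21.35)] -/
theorem depth_toWExpr_le {P : ArithCircuit k σ} (h2 : P.IsFanInTwo) : P.toWExpr.depth ≤ P.depth :=
  depth_wexprIn_le P.gates h2 P.output

end ArithCircuit

end Literature.Computability.AlgebraicComplexity
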